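import Summits.ResolutionOfSingularities.ResolutionOfSingularities.Theses.HomologicalConductor
import HarnessLib

/-!
# The cusp-cylinder certificate (negative evidence for crux `HomologicalConductor.Globalisation`,
# `Summit.ResolutionOfSingularities.ResolutionOfSingularities.Theses.HomologicalConductor.Globalisation`;
# this file does NOT refute the crux, which is implied by the summit)

Supports item stmt-ResolutionOfSingularities-16486 (crux `Globalisation` of route
`ResolutionOfSingularities/HomologicalConductor`) on the NEGATIVE lane: it is the ring-theoretic
certificate inside the refutation (on paper, crux workfile `CRUX-ATTACK-HomologicalConductor-r1.md`)
of the birth line's load-bearing stub `CaSheaf p` ("the Iyengar–Takahashi cohomology annihilator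
localises: `ca(R)·U⁻¹R = ca(U⁻¹R)` for finitely generated domains over a field of characteristic
`p`").

The witness is the cusp-cylinder `R = k[x,y,z]/(y² − x³)` with its singular line `𝔮 = (x, y)`:
`x ∈ ca(R_𝔮)` (the conductor `t²·T̄` of the cusp over `k(z)` annihilates `Ext^{≥2}`), while for
every `s ∉ 𝔮` the element `s·x` is NOT in `ca(R)`. The second half rests on the matrix
factorisation of `f = y² − x³` over `P = k[x,y,z]`
`φ_g = [[y + xg, x²], [x − g², y − xg]]`, `ψ_g = adj φ_g = [[y − xg, −x²], [−x + g², y + xg]]`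
(`φ_g ψ_g = f·1`), `g ∈ k[z]`: if `s·x` annihilated `Ext¹_R(M, ΩM)` for `M = coker φ_g`, then
`s·x·id_M` would factor through the free cover, which unwinds (Iyengar–Takahashi 2014, Rem. 2.13,
Lemma 2.14; Eisenbud's periodic resolution) to a matrix identity
`(s·x)·1 + κ φ_g = ψ_g Λ` in `M₂(P)`. The theorem below shows that NO such `κ, Λ` exist as soon as
`g ≠ 0` and `g ∤ s` (read `s` as its restriction `s(0,0,z)` to the singular line): the `(1,1)`
entry, evaluated at `y = 0`, then `x = 0`, forces `g ∣ s`.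

We model `k[x,y,z]` as the iterated polynomial ring `k[z][x][y]`
(`Polynomial (Polynomial (Polynomial k))`: the outer variable is `y`, `C X` is `x`, `C (C g)` is
`g(z)`), so that "set `y = 0`" and "set `x = 0`" are `Polynomial.eval 0`.
-/

set_option linter.dupNamespace false

namespace Summit.ResolutionOfSingularities.ResolutionOfSingularities.Theorems.Globalisation.Negative

open Polynomial

variable {k : Type*} [Field k]

/-- **Cusp-cylinder certificate.** Over `P = k[z][x][y]` (outer variable `y`, then `x`, and
`g, s ∈ k[z]` embedded as constants), for `g ≠ 0` with `g ∤ s` there are no `2 × 2` matrices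
`κ, Λ` with `(s·x)·1 + κ·φ_g = ψ_g·Λ`, where `φ_g = [[y + xg, x²], [x − g², y − xg]]` and
`ψ_g = [[y − xg, −x²], [g² − x, y + xg]]` is its adjugate (`φ_g ψ_g = (y² − x³)·1`). This is the
statement "`s·x` does not act stably trivially on the maximal Cohen–Macaulay module `coker φ_g`
of the cusp-cylinder `k[x,y,z]/(y² − x³)`", i.e. the computational core of
`s·x ∉ ca(k[x,y,z]/(y² − x³))` for every `s` not vanishing identically on the singular line.
[cite: IyengarTakahashi2014, Remark 2.13 and Lemma 2.14 (annihilation of `Ext¹(M, ΩM)` ⟺ the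
homothety factors through the free cover)] -/
theorem cuspCylinder_certificate (g s : k[X]) (hg : g ≠ 0) (hgs : ¬ g ∣ s)
    (κ Λ : Matrix (Fin 2) (Fin 2) (Polynomial (Polynomial (Polynomial k)))) :
    (C (C s) * C X : Polynomial (Polynomial (Polynomial k))) • (1 : Matrix (Fin 2) (Fin 2) (Polynomial (Polynomial (Polynomial k)))) +
        κ * (!![X + C X * C (C g), C X ^ 2; C X - C (C g) ^ 2, X - C X * C (C g)] :
          Matrix (Fin 2) (Fin 2) (Polynomial (Polynomial (Polynomial k)))) ≠
      (!![X - C X * C (C g), -(C X ^ 2); C (C g) ^ 2 - C X, X + C X * C (C g)] :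
          Matrix (Fin 2) (Fin 2) (Polynomial (Polynomial (Polynomial k)))) * Λ := by
  intro h
  -- the (0,0) entry of the matrix identity
  have h00 := congrArg (fun M : Matrix (Fin 2) (Fin 2) (Polynomial (Polynomial (Polynomial k))) => M 0 0) h
  simp only [Matrix.add_apply, Matrix.smul_apply, Matrix.one_apply_eq, smul_eq_mul, mul_one,
    Matrix.mul_apply, Fin.sum_univ_two, Matrix.of_apply, Matrix.cons_val', Matrix.cons_val_zero,
    Matrix.cons_val_one, Matrix.empty_val', Matrix.cons_val_fin_one] at h00
  -- set y = 0 : an identity in k[z][x]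
  have h1 := congrArg (Polynomial.eval (0 : Polynomial (Polynomial k))) h00
  simp only [eval_add, eval_mul, eval_sub, eval_neg, eval_pow, eval_C, eval_X, zero_add,
    zero_sub] at h1
  -- set x = 0 : an identity in k[z]
  have h2 := congrArg (Polynomial.eval (0 : Polynomial k)) h1
  simp only [eval_add, eval_mul, eval_sub, eval_neg, eval_pow, eval_C, eval_X, zero_add,
    zero_sub, zero_mul, mul_zero, neg_zero, ne_eq, OfNat.ofNat_ne_zero, not_false_eq_true,
    zero_pow] at h2
  -- h2 : the constant term of `eval 0 (κ 0 1)` times `g²` vanishes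
  have hb0 : eval 0 (eval 0 (κ 0 1)) = 0 := by
    have hmul : eval 0 (eval 0 (κ 0 1)) * g ^ 2 = 0 := by linear_combination -h2
    rcases mul_eq_zero.mp hmul with h' | h'
    · exact h'
    · exact absurd ((pow_eq_zero_iff two_ne_zero).mp h') hg
  -- so `x` divides `eval 0 (κ 0 1)`
  obtain ⟨m, hm⟩ : (X : Polynomial (Polynomial k)) ∣ eval 0 (κ 0 1) :=
    Polynomial.X_dvd_iff.mpr (by simpa [Polynomial.coeff_zero_eq_eval_zero] using hb0)
  rw [hm] at h1
  -- cancel `x` in the domain `k[z][x]`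
  have h3 : (X : Polynomial (Polynomial k)) *
      (C s + eval 0 (κ 0 0) * C g + m * (X - C g ^ 2) + C g * eval 0 (Λ 0 0) +
        X * eval 0 (Λ 1 0)) = 0 := by
    linear_combination h1
  have h4 : C s + eval 0 (κ 0 0) * C g + m * (X - C g ^ 2) + C g * eval 0 (Λ 0 0) +
      X * eval 0 (Λ 1 0) = 0 := by
    rcases mul_eq_zero.mp h3 with h' | h'
    · exact absurd h' Polynomial.X_ne_zero
    · exact h'
  -- set x = 0 once more: `s = g · (…)` in `k[z]`
  have h5 := congrArg (Polynomial.eval (0 : Polynomial k)) h4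
  simp only [eval_add, eval_mul, eval_sub, eval_pow, eval_C, eval_X, zero_mul, add_zero,
    zero_sub, eval_zero] at h5
  exact hgs ⟨-(eval 0 (eval 0 (κ 0 0))) + eval 0 m * g - eval 0 (eval 0 (Λ 0 0)), by
    linear_combination h5⟩

/-- Sanity: `φ_g ψ_g = (y² − x³)·1` — the pair IS a matrix factorisation of the cusp-cylinder
equation (so `coker φ_g` is a maximal Cohen–Macaulay module over `k[x,y,z]/(y² − x³)`, with the
2-periodic free resolution given by `φ_g, ψ_g`). [cite: IyengarTakahashi2014, Example 2.8
(periodic resolutions over hypersurfaces as sources of non-vanishing `Ext`)] -/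
theorem cuspCylinder_isMatrixFactorization (g : k[X]) :
    (!![X + C X * C (C g), C X ^ 2; C X - C (C g) ^ 2, X - C X * C (C g)] :
        Matrix (Fin 2) (Fin 2) (Polynomial (Polynomial (Polynomial k)))) *
      (!![X - C X * C (C g), -(C X ^ 2); C (C g) ^ 2 - C X, X + C X * C (C g)] :
        Matrix (Fin 2) (Fin 2) (Polynomial (Polynomial (Polynomial k)))) =
      (X ^ 2 - C X ^ 3 : Polynomial (Polynomial (Polynomial k))) • (1 : Matrix (Fin 2) (Fin 2) (Polynomial (Polynomial (Polynomial k)))) := by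
  refine Matrix.ext fun i j => ?_
  fin_cases i <;> fin_cases j <;>
    simp [Matrix.mul_apply, Fin.sum_univ_two] <;> ring

end Summit.ResolutionOfSingularities.ResolutionOfSingularities.Theorems.Globalisation.Negative
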